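import Literature.NumberTheory.LFunctions.Zhang2022.DetectorConeClosure
import Literature.NumberTheory.LFunctions.Zhang2022.RepairDetEntangled

/-!
# Zhang (2022), programme F-S3 (cell landau-siegel, §E E-102): HEAD 2 ⇒ HEAD 1 ON SINGLE-NODE PALETTES —
# the repeated-shift members `(a; x)` (`K = 1`, triple `(a,x,x)`) of the entangled cone follow from the monomial cone
# by confluence

Y. Zhang, *Discrete mean estimates and the Landau–Siegel zero*, arXiv:2211.02515v1 [Zhang2022LandauSiegel] —
an unrefereed manuscript under adjudication. **WHAT THIS IS NOT: not a claim about Theorems 1–2 of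
arXiv:2211.02515, about Landau–Siegel zeros, or about Parity; nothing here asserts any claim of the manuscript.**
«The programme SEARCHES and TYPES; no claim about Landau–Siegel zeros, Theorems 1–2 of arXiv:2211.02515 or a
repaired Margin232 until a kernel theorem says so.»

E-102's premise of record is `Det.EdetPremise (Set.Ioo 0 1) (Set.Ioo 0 5) = EdetCone ∧ MonomialConePSD`
(`DetectorEntangledCone` Part 5). This file proves, kernel-checked, that the SECOND head already carries the `K = 1`
slice of the FIRST: for every anchor `a ∈ (0,1)` and node `x ∈ (0,5)`,

  **`Det.conePSD_fin_one_of_monomialConePSD : MonomialConePSD (Set.Ioo 0 5) → ConePSD a ![x]`**,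

i.e. `𝔅^{dd}_{(a,x,x)}(g) ≥ 0` for every one-sided kinked `g` (the repeated-shift / «square» members `x_a·x_x²` of the
class, theory (c1)(5)). Mechanism (LINE C hygiene made load-bearing): `(a,x,x)` is a LIMIT of sign-admissible DISTINCT
triples inside the box — `(a, x, x+ε)` if `a < x`, `(a, a+ε, a+2ε)` if `a = x`, `(x, x+ε, a)` if `x < a` (`ε ↓ 0`) — on
which `MonomialConePSD` gives `𝔅_{R(b)} ≥ 0` (`formDetDD_eq_formDet`); the confluent form is continuous in the triple
(`Det.continuous_formDetDD`, `DetectorConeClosure`), so the sign passes to the limit; for `x < a` the limit triple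
`(x,x,a)` is carried to `(a,x,x)` by the permutation symmetry of the confluent divided differences (`dd2_swap_left`,
new here, with `dd2_swap_right` of `DetectorEntangledCone` / `Det.formDetDD_swap` of `RepairDetEntangled`). Consequently, once HEAD 2 is a theorem (the cell's DOUBLING
route K1–K6), every single-node member of HEAD 1 is one too; the palettes with `K ≥ 2` distinct nodes remain.
Part 4 (v2): the PAIR member `ConePSD a ![x,y]` evaluated on `(c·h, k)` (`ConePSD.pair_eval`) and the cross-profile
Cauchy–Schwarz consequence `|P_{(a,x,y)}(h,k)|² ≤ 𝔅^{dd}_{(a,x,x)}(h)·𝔅^{dd}_{(a,y,y)}(k)` for all one-sided kinked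
`h, k` (`ConePSD.norm_sq_polar_le`; theory (L2): a certified violation is a `ConeNegWitness`, i.e. an E-102 event).
0 named facts, 0 sorries.

## References

* Y. Zhang, arXiv:2211.02515v1 (2022), Prop 7.1 p.44 with (7.19)–(7.21), §8 (8.11)–(8.23); §2 Lemma 2.3.
  [cite: Zhang2022LandauSiegel, Prop 7.1 p.44]
* Cell documents (not literature): B-det/plan/E102-DISCHARGE.md v1.4 §2 (A3) / §4; barrier-plan 2026-08-27T01:45:23Z
  (DOUBLING = head-2 route of record).
-/

noncomputable section

open Complex Real ComplexConjugate Set MeasureTheory intervalIntegral Filter Topology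

namespace Literature.NumberTheory.LFunctions.Zhang2022

namespace Det

open Repair

variable {g g' : ℝ → ℂ}

/-! ### Part 1 — symmetry of the confluent divided differences in the FIRST two nodes -/

/-- The confluent second divided difference is symmetric in its first two nodes (all coincidence cases).
[cite: Zhang2022LandauSiegel, proof of Prop 7.1, (7.19)–(7.21)] -/
theorem dd2_swap_left (h h' h'' : ℝ → ℂ) (x y z : ℝ) : dd2 h h' h'' y x z = dd2 h h' h'' x y z := by
  unfold dd2
  by_cases hxy : x = y
  · subst hxy
    rfl
  · have hyx : y ≠ x := fun e => hxy e.symm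
    by_cases hyz : y = z
    · subst hyz
      simp [hxy, hyx]
    · by_cases hxz : x = z
      · subst hxz
        simp [hxy, hyx]
      · have hzy : z ≠ y := fun e => hyz e.symm
        have hzx : z ≠ x := fun e => hxz e.symm
        simp only [ne_eq, hyx, not_false_eq_true, hxz, hyz, and_self, ↓reduceIte, hxy]
        push_cast
        ring

/-- `B(x,a,y) = B(a,x,y)`. [cite: Zhang2022LandauSiegel, Lemma 5.2 p.10] -/
theorem shiftB_swap_left (a x y : ℝ) : shiftB ![x, a, y] = shiftB ![a, x, y] := by
  simp only [shiftB, Matrix.cons_val_zero, Matrix.cons_val_one, Matrix.cons_val_two, Matrix.head_cons,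
    Matrix.tail_cons]
  ring

/-- The dd-values are symmetric in the first two nodes. [cite: Zhang2022LandauSiegel, proof of Prop 7.1, (7.19)–(7.21)] -/
theorem ddOf_swap_left (a x y : ℝ) (k : ℕ) : ddOf ![x, a, y] k = ddOf ![a, x, y] k := by
  simp only [ddOf, shiftB_swap_left a x y, Matrix.cons_val_zero, Matrix.cons_val_one, Matrix.cons_val_two,
    Matrix.head_cons, Matrix.tail_cons]
  exact dd2_swap_left _ _ _ a x y

/-- `b₀b₁b₂` is symmetric in the first two nodes. [folklore] -/
private theorem prod_swap_left (a x y : ℝ) :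
    (![x, a, y] : Fin 3 → ℝ) 0 * (![x, a, y] : Fin 3 → ℝ) 1 * (![x, a, y] : Fin 3 → ℝ) 2
      = (![a, x, y] : Fin 3 → ℝ) 0 * (![a, x, y] : Fin 3 → ℝ) 1 * (![a, x, y] : Fin 3 → ℝ) 2 := by
  simp only [Matrix.cons_val_zero, Matrix.cons_val_one, Matrix.cons_val_two, Matrix.head_cons, Matrix.tail_cons]
  ring

/-- Formula I of `(x,a,y)` is formula I of `(a,x,y)` (all six dd-moments agree). [cite: Zhang2022LandauSiegel, Prop 7.1 p.44, (8.11)–(8.12)] -/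
theorem mformDD_swap_left (a x y : ℝ) (g g' h h' : ℝ → ℂ) :
    MformDD ![x, a, y] g g' h h' = MformDD ![a, x, y] g g' h h' := by
  have h0 : ddM0 ![x, a, y] = ddM0 ![a, x, y] := ddOf_swap_left a x y 1
  have hb : ddMb ![x, a, y] = ddMb ![a, x, y] := ddOf_swap_left a x y 2
  have hs : ddMs ![x, a, y] = ddMs ![a, x, y] := by rw [ddMs, ddMs, shiftB_swap_left, h0, hb]
  have hn : ddMn ![x, a, y] = ddMn ![a, x, y] := by rw [ddMn, ddMn, prod_swap_left, ddOf_swap_left]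
  have hbs : ddMbs ![x, a, y] = ddMbs ![a, x, y] := by rw [ddMbs, ddMbs, shiftB_swap_left, hb, ddOf_swap_left]
  have hbn : ddMbn ![x, a, y] = ddMbn ![a, x, y] := by rw [ddMbn, ddMbn, prod_swap_left, h0]
  rw [MformDD, MformDD, h0, hs, hn, hb, hbs, hbn]

/-- The confluent diagonal form is symmetric in the first two nodes. [cite: Zhang2022LandauSiegel, Prop 7.1 p.44, (8.11)–(8.12)] -/
theorem formDetDD_swap_left (a x y : ℝ) (g g' : ℝ → ℂ) : FormDetDD ![x, a, y] g g' = FormDetDD ![a, x, y] g g' := by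
  rw [← formDetPolarDD_self_re, ← formDetPolarDD_self_re, FormDetPolarDD, FormDetPolarDD, mformDD_swap_left]

/-- `𝔅^{dd}_{(x,x,a)} = 𝔅^{dd}_{(a,x,x)}` (last-two swap `Det.formDetDD_swap` of `RepairDetEntangled`, then the
first-two swap). [cite: Zhang2022LandauSiegel, Prop 7.1 p.44, (8.11)–(8.12)] -/
theorem formDetDD_rotate (a x : ℝ) (g g' : ℝ → ℂ) : FormDetDD ![x, x, a] g g' = FormDetDD ![a, x, x] g g' := by
  rw [← formDetDD_swap x x a, formDetDD_swap_left]

/-! ### Part 2 — sign-admissible distinct approximants of a repeated triple inside the box -/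

/-- The monomial cone gives `𝔅^{dd}_c(g) ≥ 0` at every sign-admissible triple `c` in the box.
[cite: Zhang2022LandauSiegel, Prop 7.1 p.44 with (8.11)–(8.23); §2 Lemma 2.3] -/
theorem MonomialConePSD.formDetDD_nonneg (hM : MonomialConePSD (Set.Ioo 0 5)) {c : Fin 3 → ℝ}
    (hc : SignAdmissible c) (hcB : ∀ j, c j ∈ Set.Ioo (0:ℝ) 5) (hg : KinkedProfile g g') (hg1 : g 1 = 0) :
    0 ≤ FormDetDD c g g' := by
  rw [formDetDD_eq_formDet hc.injective hg hg1]
  exact hM c hc hcB g g' hg hg1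

/-- The closed half-line argument: if `c(ε)` is sign-admissible in the box for all small `ε > 0` and `c(ε) → c₀` as
`ε ↓ 0`, then `𝔅^{dd}_{c₀}(g) ≥ 0` (continuity of the confluent form in the triple, `Det.continuous_formDetDD`).
[cite: Zhang2022LandauSiegel, proof of Prop 7.1, (7.19)–(7.21)] -/
theorem formDetDD_nonneg_of_limit (hM : MonomialConePSD (Set.Ioo 0 5)) (hg : KinkedProfile g g') (hg1 : g 1 = 0)
    {c : ℝ → Fin 3 → ℝ} {c₀ : Fin 3 → ℝ} {δ : ℝ} (hδ : 0 < δ)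
    (hadm : ∀ ε ∈ Set.Ioo (0:ℝ) δ, SignAdmissible (c ε) ∧ ∀ j, c ε j ∈ Set.Ioo (0:ℝ) 5)
    (hlim : Tendsto c (𝓝[>] 0) (𝓝 c₀)) : 0 ≤ FormDetDD c₀ g g' := by
  have hclosed : IsClosed {c : Fin 3 → ℝ | 0 ≤ FormDetDD c g g'} :=
    isClosed_le continuous_const (continuous_formDetDD g g')
  refine hclosed.mem_of_tendsto hlim ?_
  filter_upwards [Ioo_mem_nhdsGT hδ] with ε hε
  exact hM.formDetDD_nonneg (hadm ε hε).1 (hadm ε hε).2 hg hg1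

/-- A path `ε ↦ ![p + uε, q + vε, r + wε]` tends to `![p,q,r]` as `ε ↓ 0`. [folklore] -/
private theorem tendsto_triple (p q r u v w : ℝ) :
    Tendsto (fun ε : ℝ => (![p + u * ε, q + v * ε, r + w * ε] : Fin 3 → ℝ)) (𝓝[>] 0) (𝓝 ![p, q, r]) := by
  have h : Continuous fun ε : ℝ => (![p + u * ε, q + v * ε, r + w * ε] : Fin 3 → ℝ) := by
    refine continuous_pi fun j => ?_
    fin_cases j <;> simp <;> fun_prop
  have h0 := (h.tendsto 0)
  simp only [mul_zero, add_zero] at h0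
  exact h0.mono_left nhdsWithin_le_nhds

/-! ### Part 3 — HEAD 2 ⇒ HEAD 1 on single-node palettes -/

/-- **`MonomialConePSD (0,5) ⇒ ConePSD a ![x]` for every `a ∈ (0,1)`, `x ∈ (0,5)`** — the repeated-shift members
`(a; x)` of the entangled cone (triple `(a,x,x)`, the «square» detectors `x_a·x_x²`) follow from the monomial cone by
confluence. [cite: Zhang2022LandauSiegel, Prop 7.1 p.44 with (7.19)–(7.21), (8.11)–(8.23); §2 Lemma 2.3] -/
theorem conePSD_fin_one_of_monomialConePSD (hM : MonomialConePSD (Set.Ioo 0 5)) {a x : ℝ}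
    (ha : a ∈ Set.Ioo (0:ℝ) 1) (hx : x ∈ Set.Ioo (0:ℝ) 5) : ConePSD a ![x] := by
  rw [conePSD_fin_one_iff]
  intro g g' hg hg1
  obtain ⟨ha0, ha1⟩ := ha
  obtain ⟨hx0, hx5⟩ := hx
  rcases lt_trichotomy a x with hax | hax | hax
  · -- a < x: approximate by (a, x, x + ε), gap k = ⌊x⌋₊
    set k : ℕ := ⌊x⌋₊ with hk
    have hkx : (k : ℝ) ≤ x := Nat.floor_le hx0.le
    have hxk : x < k + 1 := Nat.lt_floor_add_one x
    have hk5 : (k : ℝ) + 1 ≤ 5 := by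
      have : k ≤ 4 := by
        rw [hk]; exact Nat.le_of_lt_succ (Nat.floor_lt hx0.le |>.2 (by norm_num; linarith))
      exact_mod_cast Nat.succ_le_of_lt (Nat.lt_succ_of_le this)
    refine formDetDD_nonneg_of_limit hM hg hg1 (c := fun ε => ![a + 0 * ε, x + 0 * ε, x + 1 * ε])
      (δ := k + 1 - x) (by linarith) (fun ε hε => ?_) (by simpa using tendsto_triple a x x 0 0 1)
    obtain ⟨hε0, hεδ⟩ := hε
    refine ⟨⟨?_, ?_, ?_, ?_, k, ?_, ?_⟩, fun j => ?_⟩ <;>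
      simp only [Matrix.cons_val_zero, Matrix.cons_val_one, Matrix.cons_val_two, Matrix.head_cons,
        Matrix.tail_cons, zero_mul, add_zero, one_mul]
    · exact ha0
    · exact hax
    · linarith
    · exact ha1.le
    · exact hkx
    · linarith
    · fin_cases j <;> simp <;> refine ⟨by linarith, by linarith⟩
  · -- a = x: approximate by (a, a + ε, a + 2ε), gap k = 0
    subst hax
    refine formDetDD_nonneg_of_limit hM hg hg1 (c := fun ε => ![a + 0 * ε, a + 1 * ε, a + 2 * ε])
      (δ := (1 - a) / 2) (by linarith) (fun ε hε => ?_) (by simpa using tendsto_triple a a a 0 1 2)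
    obtain ⟨hε0, hεδ⟩ := hε
    refine ⟨⟨?_, ?_, ?_, ?_, 0, ?_, ?_⟩, fun j => ?_⟩ <;>
      simp only [Matrix.cons_val_zero, Matrix.cons_val_one, Matrix.cons_val_two, Matrix.head_cons,
        Matrix.tail_cons, zero_mul, add_zero, one_mul, Nat.cast_zero, zero_add]
    · exact ha0
    · linarith
    · linarith
    · exact ha1.le
    · linarith
    · linarith
    · fin_cases j <;> simp <;> refine ⟨by linarith, by linarith⟩
  · -- x < a (< 1): approximate (x, x, a) by (x, x + ε, a), gap k = 0, then rotate to (a, x, x)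
    rw [← formDetDD_rotate]
    refine formDetDD_nonneg_of_limit hM hg hg1 (c := fun ε => ![x + 0 * ε, x + 1 * ε, a + 0 * ε])
      (δ := a - x) (by linarith) (fun ε hε => ?_) (by simpa using tendsto_triple x x a 0 1 0)
    obtain ⟨hε0, hεδ⟩ := hε
    refine ⟨⟨?_, ?_, ?_, ?_, 0, ?_, ?_⟩, fun j => ?_⟩ <;>
      simp only [Matrix.cons_val_zero, Matrix.cons_val_one, Matrix.cons_val_two, Matrix.head_cons,
        Matrix.tail_cons, zero_mul, add_zero, one_mul, Nat.cast_zero, zero_add]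
    · exact hx0
    · linarith
    · linarith
    · linarith
    · linarith
    · linarith
    · fin_cases j <;> simp <;> refine ⟨by linarith, by linarith⟩

/-- **E-102 bookkeeping:** under the word's premise head 2 alone, every single-node entangled member is decided —
`EdetPremise`'s first conjunct restricted to `K = 1` palettes is a consequence of the second.
[cite: Zhang2022LandauSiegel, Prop 7.1 p.44 with (8.11)–(8.23); §2 Lemma 2.3] -/
theorem edetCone_fin_one_of_monomialConePSD (hM : MonomialConePSD (Set.Ioo 0 5)) (a : ℝ)
    (ha : a ∈ Set.Ioo (0:ℝ) 1) (b : Fin 1 → ℝ) (hb : ∀ j, b j ∈ Set.Ioo (0:ℝ) 5) : ConePSD a b := by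
  have hb' : b = ![b 0] := by funext j; fin_cases j; rfl
  rw [hb']
  exact conePSD_fin_one_of_monomialConePSD hM ha (hb 0)

/-! ### Part 4 (v2) — PAIR palettes: `ConePSD a ![x,y]` ⟺ the two single-node members ∧ the cross-profile
Cauchy–Schwarz inequality (theory g2 (L2), REF-B1's «HEAD-1 falsifier (K = 2, two profiles)» in kernel form) -/

section Pair

variable {h h' k k' : ℝ → ℂ}

/-- The `K = 2` block sum: `m(a;(x,y);(h,k)) = P_{(a,x,x)}(h,h) + P_{(a,x,y)}(h,k) + P_{(a,y,x)}(k,h) + P_{(a,y,y)}(k,k)`.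
[cite: Zhang2022LandauSiegel, Prop 7.1 p.44, (7.19)–(7.21)] -/
theorem entangledMain_fin_two (a x y : ℝ) (h h' : Fin 2 → ℝ → ℂ) :
    entangledMain a ![x, y] h h'
      = FormDetPolarDD ![a, x, x] (h 0) (h' 0) (h 0) (h' 0) + FormDetPolarDD ![a, x, y] (h 0) (h' 0) (h 1) (h' 1)
        + (FormDetPolarDD ![a, y, x] (h 1) (h' 1) (h 0) (h' 0) + FormDetPolarDD ![a, y, y] (h 1) (h' 1) (h 1) (h' 1)) := by
  simp [entangledMain, Fin.sum_univ_two]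

/-- Its real part: `Re m = 𝔅^{dd}_{(a,x,x)}(h) + 2·Re P_{(a,x,y)}(h,k) + 𝔅^{dd}_{(a,y,y)}(k)` (the `(y,x)` block is the
conjugate of the `(x,y)` block). [cite: Zhang2022LandauSiegel, Prop 7.1 p.44, (7.19)–(7.21)] -/
theorem entangledMain_fin_two_re (a x y : ℝ) (h h' : Fin 2 → ℝ → ℂ) :
    (entangledMain a ![x, y] h h').re
      = FormDetDD ![a, x, x] (h 0) (h' 0) + 2 * (FormDetPolarDD ![a, x, y] (h 0) (h' 0) (h 1) (h' 1)).re
        + FormDetDD ![a, y, y] (h 1) (h' 1) := by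
  rw [entangledMain_fin_two, formDetPolarDD_swap a x y, ← formDetPolarDD_conj ![a, x, y] (h 0) (h' 0) (h 1) (h' 1)]
  simp only [Complex.add_re, Complex.conj_re, formDetPolarDD_self_re]
  ring

/-- **`ConePSD a ![x,y]` evaluated on a pair of one-sided kinked profiles** with a complex weight on the first:
`|c|²·𝔅_{(a,x,x)}(h) + 2Re(c·P_{(a,x,y)}(h,k)) + 𝔅_{(a,y,y)}(k) ≥ 0`. [cite: Zhang2022LandauSiegel, Prop 7.1 p.44, (7.2); §2 (2.32)] -/
theorem ConePSD.pair_eval {a x y : ℝ} (hP : ConePSD a ![x, y]) (hh : KinkedProfile h h') (hh1 : h 1 = 0)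
    (hk : KinkedProfile k k') (hk1 : k 1 = 0) (c : ℂ) :
    0 ≤ ‖c‖ ^ 2 * FormDetDD ![a, x, x] h h' + 2 * (c * FormDetPolarDD ![a, x, y] h h' k k').re
        + FormDetDD ![a, y, y] k k' := by
  have hv := hP (![c • h, k]) (![c • h', k'])
    (fun j => by fin_cases j <;> [exact hh.smul c; exact hk])
    (fun j => by fin_cases j <;> simp [hh1, hk1])
  rw [entangledMain_fin_two_re] at hv
  simp only [Matrix.cons_val_zero, Matrix.cons_val_one] at hv
  have h1 : FormDetDD ![a, x, x] (c • h) (c • h') = ‖c‖ ^ 2 * FormDetDD ![a, x, x] h h' := by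
    rw [← formDetPolarDD_self_re, formDetPolarDD_smul, Complex.mul_conj', ← formDetPolarDD_self_re]
    rw [show ((c : ℂ) : ℂ) = c from rfl, ← Complex.ofReal_pow, Complex.re_ofReal_mul]
  have h2 : FormDetPolarDD ![a, x, y] (c • h) (c • h') k k' = c * FormDetPolarDD ![a, x, y] h h' k k' := by
    have := formDetPolarDD_smul ![a, x, y] c 1 h h' k k'
    simpa using this
  rw [h1, h2] at hv
  exact hv

/-- The 2×2 Hermitian positivity lemma behind Cauchy–Schwarz: if `|c|²A + 2Re(cP) + C ≥ 0` for every complex `c`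
(with `A ≥ 0`), then `|P|² ≤ AC`. [folklore] -/
private theorem norm_sq_le_of_forall_weight {A C : ℝ} {P : ℂ} (hA : 0 ≤ A)
    (h : ∀ c : ℂ, 0 ≤ ‖c‖ ^ 2 * A + 2 * (c * P).re + C) : ‖P‖ ^ 2 ≤ A * C := by
  have hPP : conj P * P = ((‖P‖ ^ 2 : ℝ) : ℂ) := by rw [Complex.conj_mul', Complex.ofReal_pow]
  rcases hA.lt_or_eq with hApos | hA0
  · have hv := h (-(conj P) / (A : ℂ))
    have hre : ((-(conj P) / (A : ℂ)) * P).re = -(‖P‖ ^ 2) / A := by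
      rw [div_mul_eq_mul_div, neg_mul, hPP, ← Complex.ofReal_neg, ← Complex.ofReal_div, Complex.ofReal_re, neg_div]
    have hnorm : ‖-(conj P) / (A : ℂ)‖ ^ 2 = ‖P‖ ^ 2 / A ^ 2 := by
      rw [norm_div, norm_neg, Complex.norm_conj, Complex.norm_real, Real.norm_eq_abs, abs_of_pos hApos, div_pow]
    rw [hre, hnorm] at hv
    have h1 : ‖P‖ ^ 2 / A ^ 2 * A = ‖P‖ ^ 2 / A := by field_simp
    have h2 : 0 ≤ C - ‖P‖ ^ 2 / A := by
      rw [h1] at hv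
      have e : -‖P‖ ^ 2 / A = -(‖P‖ ^ 2 / A) := neg_div _ _
      rw [e] at hv
      linarith
    have h3 : A * (C - ‖P‖ ^ 2 / A) = A * C - ‖P‖ ^ 2 := by field_simp
    nlinarith [mul_nonneg hApos.le h2]
  · subst hA0
    rw [zero_mul]
    by_contra hne
    have hpos : 0 < ‖P‖ ^ 2 := lt_of_not_ge hne
    set t : ℝ := (C + 1) / ‖P‖ ^ 2 with ht
    have hv := h (-((t : ℝ) : ℂ) * conj P)
    have hre : ((-((t : ℝ) : ℂ) * conj P) * P).re = -(t * ‖P‖ ^ 2) := by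
      rw [mul_assoc, hPP, ← Complex.ofReal_neg, ← Complex.ofReal_mul, Complex.ofReal_re, neg_mul]
    rw [hre, mul_zero, zero_add] at hv
    have htt : t * ‖P‖ ^ 2 = C + 1 := by rw [ht, div_mul_cancel₀ _ (ne_of_gt hpos)]
    have hC : 0 ≤ C := by have := h 0; simpa using this
    linarith

/-- The single-node sub-members of a pair member. [cite: Zhang2022LandauSiegel, Prop 7.1 p.44, (7.2)] -/
theorem ConePSD.pair_left {a x y : ℝ} (hP : ConePSD a ![x, y]) : ConePSD a ![x] := by
  have h := hP.comp (σ := fun _ : Fin 1 => (0 : Fin 2)) (fun i j _ => Subsingleton.elim i j)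
  have e : ((![x, y] : Fin 2 → ℝ) ∘ fun _ : Fin 1 => (0 : Fin 2)) = ![x] := by
    funext j; fin_cases j; rfl
  rwa [e] at h

/-- The single-node sub-members of a pair member. [cite: Zhang2022LandauSiegel, Prop 7.1 p.44, (7.2)] -/
theorem ConePSD.pair_right {a x y : ℝ} (hP : ConePSD a ![x, y]) : ConePSD a ![y] := by
  have h := hP.comp (σ := fun _ : Fin 1 => (1 : Fin 2)) (fun i j _ => Subsingleton.elim i j)
  have e : ((![x, y] : Fin 2 → ℝ) ∘ fun _ : Fin 1 => (1 : Fin 2)) = ![y] := by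
    funext j; fin_cases j; rfl
  rwa [e] at h

/-- **Cross-profile Cauchy–Schwarz from the pair member:** `ConePSD a ![x,y]` gives
`|P_{(a,x,y)}(h,k)|² ≤ 𝔅_{(a,x,x)}(h)·𝔅_{(a,y,y)}(k)` for ALL one-sided kinked `h, k` (the `h = k`, real-weight slice is
`Det.formDetDD_sq_le_of_conePSD`). [cite: Zhang2022LandauSiegel, §2 (2.18)–(2.19), (2.32)–(2.33); Prop 7.1 p.44] -/
theorem ConePSD.norm_sq_polar_le {a x y : ℝ} (hP : ConePSD a ![x, y]) (hh : KinkedProfile h h') (hh1 : h 1 = 0)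
    (hk : KinkedProfile k k') (hk1 : k 1 = 0) :
    ‖FormDetPolarDD ![a, x, y] h h' k k'‖ ^ 2 ≤ FormDetDD ![a, x, x] h h' * FormDetDD ![a, y, y] k k' :=
  norm_sq_le_of_forall_weight ((conePSD_fin_one_iff a x).1 hP.pair_left h h' hh hh1)
    (fun c => hP.pair_eval hh hh1 hk hk1 c)

/-- **The pair member in closed form:** `ConePSD a ![x,y]` iff the two single-node members hold and the cross-profile
Cauchy–Schwarz inequality holds for every pair of one-sided kinked profiles (theory g2 (L2): head 1 at `K = 2` IS this
2×2 statement; a certified violation is a `ConeNegWitness`). [cite: Zhang2022LandauSiegel, §2 (2.18)–(2.19), (2.32)–(2.33); Prop 7.1 p.44] -/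
theorem conePSD_pair_iff (a x y : ℝ) :
    ConePSD a ![x, y] ↔ ConePSD a ![x] ∧ ConePSD a ![y] ∧
      ∀ h h' k k' : ℝ → ℂ, KinkedProfile h h' → h 1 = 0 → KinkedProfile k k' → k 1 = 0 →
        ‖FormDetPolarDD ![a, x, y] h h' k k'‖ ^ 2 ≤ FormDetDD ![a, x, x] h h' * FormDetDD ![a, y, y] k k' := by
  constructor
  · intro hP
    exact ⟨hP.pair_left, hP.pair_right, fun h h' k k' hh hh1 hk hk1 => hP.norm_sq_polar_le hh hh1 hk hk1⟩
  · rintro ⟨hx, hy, hcs⟩ hv hv' hkin h1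
    rw [entangledMain_fin_two_re]
    have hA := (conePSD_fin_one_iff a x).1 hx (hv 0) (hv' 0) (hkin 0) (h1 0)
    have hC := (conePSD_fin_one_iff a y).1 hy (hv 1) (hv' 1) (hkin 1) (h1 1)
    have hPs := hcs (hv 0) (hv' 0) (hv 1) (hv' 1) (hkin 0) (h1 0) (hkin 1) (h1 1)
    -- 2|Re P| ≤ 2|P| ≤ 2√(AC) ≤ A + C
    have hre : |(FormDetPolarDD ![a, x, y] (hv 0) (hv' 0) (hv 1) (hv' 1)).re|
        ≤ ‖FormDetPolarDD ![a, x, y] (hv 0) (hv' 0) (hv 1) (hv' 1)‖ := Complex.abs_re_le_norm _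
    set R : ℝ := (FormDetPolarDD ![a, x, y] (hv 0) (hv' 0) (hv 1) (hv' 1)).re
    set N : ℝ := ‖FormDetPolarDD ![a, x, y] (hv 0) (hv' 0) (hv 1) (hv' 1)‖
    set A : ℝ := FormDetDD ![a, x, x] (hv 0) (hv' 0)
    set C : ℝ := FormDetDD ![a, y, y] (hv 1) (hv' 1)
    have hN : 0 ≤ N := norm_nonneg _
    -- (√A·… ) free: N² ≤ AC and AM-GM ⇒ 2N ≤ A + C is false in general; use (A + C)² ≥ 4AC ≥ 4N² with A + C ≥ 0
    have hsum : 0 ≤ A + C := add_nonneg hA hC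
    have h4 : (2 * N) ^ 2 ≤ (A + C) ^ 2 := by nlinarith [hPs, sq_nonneg (A - C)]
    have h2N : 2 * N ≤ A + C := (pow_le_pow_iff_left₀ (by positivity) hsum two_ne_zero).1 h4
    have hRle : -N ≤ R := (abs_le.1 hre).1
    linarith

end Pair

end Det

end Literature.NumberTheory.LFunctions.Zhang2022
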